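import Mathlib
import HarnessLib
import Summits.NavierStokesRegularity.NavierStokesRegularity.Theorems.TaylorModelRungThreeCertificateReadoutVStepWin
import Summits.NavierStokesRegularity.NavierStokesRegularity.Theorems.TaylorModelRungThreeCertificateReadoutVStepSound

/-!
# Crux K1b-DR (stmt-NavierStokesRegularity-23954), line `taylor-model` — v3 read-outs, K-SIDE part 4b-W: SOUNDNESS of the
# WINDOWED read-out step `readoutStepWin`, clause by clause (ns-tm-g4 g6; window analogue of typer g32's `…ReadoutVStepSound`)

From `(T.readoutStepWin rw).ok = true`, the kit hypotheses and the enclosure hypotheses of the scalar inputs: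
* `readoutStepWin_win` — the window order `0 ≤ u1lo ≤ u0lo ≤ u0hi ≤ u1hi ≤ h` (reals);
* `readoutStepWin_R5` — section before/after at the nodes (unchanged); `readoutStepWin_R7` — transversality on the FAT box `Y1`;
* `readoutStepWin_Zl` — the WINDOWED in-step box over a `u`-box `U`: contains `TP(u) + r + A·(y − x)` for `u ∈ U`,
  `u ∈ [u1lo, u1hi]`, `0 ≤ u ≤ uR`, an in-step kernel `A` at `u`, `y ∈ Hl`, `|r| ≤ J·u^(p+1)` (generic form of (R6w) and of the four
  endpoint boxes);
* `readoutStepWin_R5w1` / `readoutStepWin_R5w0` — the WINDOW-END section tests: `σf < lev` on `Z1a`/`Z0a`, `lev < σf` on `Z1b`/`Z0b`;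
* `readoutStepWin_R8` — crossing read-outs on `Z1`; `readoutStepWin_R9` — base landing on `Z0` per face;
* `readoutStepWin_R10` — `A·(Vc + B·W) ∈ VBw` for in-step kernels `A` at `u ∈ [u1lo, u1hi]`, `W ∈ [Z]`;
* `readoutStepWin_R11` — the landing-derivative bound per face on `Z1`.

HONEST FRAMING: kernel bookkeeping for the MODEL certificate №23954 (rung TL-M3); nothing here is a statement about the
Navier–Stokes equations.
-/

-- the sub-problem namespace repeats the summit name by design (D-0017)
set_option linter.dupNamespace false

namespace Summit.NavierStokesRegularity.NavierStokesRegularity.Theorems.TaylorModelCert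

open scoped BigOperators
open Set
open Literature.Analysis.FluidPDE.TaoCascade Literature.Analysis.FluidPDE.TaoCascade.TaylorChain
open Summit.NavierStokesRegularity.NavierStokesRegularity.Theorems.TaylorModelReadout (taylorJet varJet)
open Summit.NavierStokesRegularity.NavierStokesRegularity.Theorems.TaylorModelV (basisSt)

namespace CertTables

variable {K : Type} [Field K] {φ : K →+* ℝ} (T : CertTables K) (rw : ROInWin)

omit [Field K] in
/-- **Window order** from the windowed read-out step. [folklore] -/
theorem readoutStepWin_win (hok : (T.readoutStepWin rw).ok = true) :
    0 ≤ rw.u1lo.toReal ∧ rw.u1lo.toReal ≤ rw.u0lo.toReal ∧ rw.u0lo.toReal ≤ rw.u0hi.toReal ∧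
      rw.u0hi.toReal ≤ rw.u1hi.toReal ∧ rw.u1hi.toReal ≤ rw.base.h.toReal :=
  winOK_sound (T.readoutStepWin_ok rw hok).1

/-- **(R5)** (at the nodes) from the windowed read-out step. [folklore] -/
theorem readoutStepWin_R5 (hok : (T.readoutStepWin rw).ok = true) {wσ : List K}
    (hW : ∀ c < T.n, IntervalD.mem (φ (vget wσ c)) (IntervalD.aget rw.base.Wσ c)) {lev : ℝ} (hL : IntervalD.mem lev rw.base.LB) :
    (∀ y : Fin 4 → ℤ → ℝ, MemVec T.n (T.wv y) rw.base.H1 → T.covR φ wσ y < lev) ∧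
    (∀ y : Fin 4 → ℤ → ℝ, MemVec T.n (T.wv y) rw.base.Ha1 → lev < T.covR φ wσ y) :=
  T.testR5_sound hW hL (T.readoutStepWin_ok rw hok).2.1

/-- **(R7)** on the fat level-1 box from the windowed read-out step. [folklore] -/
theorem readoutStepWin_R7 (hco : T.CoefOK φ) (hcB : CoefBoxOK φ T rw.base.coefB) (hmt : rw.base.mt = T.monosTable rw.base.coefB)
    (hok : (T.readoutStepWin rw).ok = true) {wσ : List K} (hW : ∀ c < T.n, IntervalD.mem (φ (vget wσ c)) (IntervalD.aget rw.base.Wσ c))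
    {γ : ℝ} (hG : IntervalD.mem γ rw.base.GB) :
    ∀ y : Fin 4 → ℤ → ℝ, MemVec T.n (T.wv y) (rw.base.Y1 T) → γ ≤ T.covR φ wσ ((T.toCertData φ).Qb y y) :=
  T.testR7_sound hco hcB hmt hW hG (T.size_Y1 rw.base) (T.readoutStepWin_ok rw hok).2.2.1

/-- **The windowed in-step box (generic (R6w))**: for `u ∈ U`, `u ∈ [u1lo, u1hi]`, `0 ≤ u ≤ uR`, an in-step kernel `A` at `u`
(window form of `InStepKer`), a state `y ∈ Hl` and a remainder `r` with `|wv r c| ≤ J_c·u^(p+1)`, the state `TP(u) + r + A·(y − x)`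
lies in `Zl U uR Hl`, coordinatewise. [folklore] -/
theorem readoutStepWin_Zl (hco : T.CoefOK φ) (hcB : CoefBoxOK φ T rw.base.coefB) (hmt : rw.base.mt = T.monosTable rw.base.coefB)
    (hH2 : rw.base.H2.size = T.n) {U : IntervalD} {uR : Dyad}
    {u : ℝ} (huU : IntervalD.mem u U) (hu0 : 0 ≤ u) (hulo : rw.u1lo.toReal ≤ u) (huhi : u ≤ rw.u1hi.toReal) (huR : u ≤ uR.toReal)
    {ω : ℤ → ℝ} (hω : ∀ i k, -T.Kb ≤ k → k ≤ T.Ka → IntervalD.mem ((ω k)⁻¹) (IntervalD.aget rw.base.ωinvB (T.idx i k)))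
    {A : Fin 4 → ℤ → Fin 4 → ℤ → ℝ}
    (hA : ∀ i' k', -T.Kb ≤ k' → k' ≤ T.Ka → ∀ i k, -T.Kb ≤ k → k ≤ T.Ka →
      ∃ ζ : Fin 4 → ℤ → ℝ, T.InBoxW (T.vecF (IntervalD.loR rw.base.H2)) (T.vecF (IntervalD.hiR rw.base.H2)) ζ ∧
        |A i' k' i k - ∑ n ∈ Finset.range (rw.base.pV + 1), varJet (T.toCertData φ).Qb ζ (basisSt i k) n i' k' * u ^ n|
          ≤ T.vecF (vre rw.base.JU) i' k' * (ω k)⁻¹ * u ^ (rw.base.pV + 1))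
    {Hl : Array IntervalD} {y : Fin 4 → ℤ → ℝ} (hy : MemVec T.n (T.wv y) Hl)
    {r : Fin 4 → ℤ → ℝ} (hr : ∀ c < T.n, |T.wv r c| ≤ vre rw.base.J c * u ^ (rw.base.p + 1)) :
    MemVec T.n (fun c => (∑ n ∈ Finset.range (rw.base.p + 1),
          taylorJet (T.toCertData φ).Qb (T.vecF (vre rw.base.x)) n (T.wi c) (T.wk c) * u ^ n)
        + T.wv r c + ∑ c' ∈ Finset.range T.n, A (T.wi c) (T.wk c) (T.wi c') (T.wk c') * (T.wv y c' - vre rw.base.x c'))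
      (rw.Zl T U uR Hl) := by
  intro c hc
  have htp : ∀ c < T.n, IntervalD.mem (∑ n ∈ Finset.range (rw.base.p + 1),
      taylorJet (T.toCertData φ).Qb (T.vecF (vre rw.base.x)) n (T.wi c) (T.wk c) * u ^ n) (IntervalD.aget (rw.TPw T U) c) := by
    intro c hc
    have hk := T.InW_wk hc
    have := T.coreTP_spec hco hcB hmt rw.base.prec rw.base.p rw.base.x huU (T.wi c) hk.1 hk.2
    rwa [T.idx_wi_wk hc] at this
  have ha := T.inStepMW_memMat hco hcB rw.base.prec rw.base.pV hH2 hu0 hulo huhi rw.base.JU hω hA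
  exact T.inStepY_spec rw.base.prec rw.base.p htp hu0 huR hr ha hy rw.base.x hc

/-- **Window-end section tests, level 1**: `σf < lev` on `Z1a`, `lev < σf` on `Z1b`. [folklore] -/
theorem readoutStepWin_R5w1 (hok : (T.readoutStepWin rw).ok = true) {wσ : List K}
    (hW : ∀ c < T.n, IntervalD.mem (φ (vget wσ c)) (IntervalD.aget rw.base.Wσ c)) {lev : ℝ} (hL : IntervalD.mem lev rw.base.LB) :
    (∀ y : Fin 4 → ℤ → ℝ, MemVec T.n (T.wv y) (rw.Z1a T) → T.covR φ wσ y < lev) ∧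
    (∀ y : Fin 4 → ℤ → ℝ, MemVec T.n (T.wv y) (rw.Z1b T) → lev < T.covR φ wσ y) :=
  T.testR5_sound hW hL (T.readoutStepWin_ok rw hok).2.2.2.1

/-- **Window-end section tests, level 0**: `σf < lev` on `Z0a`, `lev < σf` on `Z0b`. [folklore] -/
theorem readoutStepWin_R5w0 (hok : (T.readoutStepWin rw).ok = true) {wσ : List K}
    (hW : ∀ c < T.n, IntervalD.mem (φ (vget wσ c)) (IntervalD.aget rw.base.Wσ c)) {lev : ℝ} (hL : IntervalD.mem lev rw.base.LB) :
    (∀ y : Fin 4 → ℤ → ℝ, MemVec T.n (T.wv y) (rw.Z0a T) → T.covR φ wσ y < lev) ∧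
    (∀ y : Fin 4 → ℤ → ℝ, MemVec T.n (T.wv y) (rw.Z0b T) → lev < T.covR φ wσ y) :=
  T.testR5_sound hW hL (T.readoutStepWin_ok rw hok).2.2.2.2.1

omit [Field K] in
/-- **(R8)** on the windowed level-1 box. [folklore] -/
theorem readoutStepWin_R8 (hok : (T.readoutStepWin rw).ok = true) {as aK R : ℝ} (has : IntervalD.mem as rw.base.ASB)
    (haK : IntervalD.mem aK rw.base.AK) (hR : rw.base.rlo.toReal ≤ R) :
    ∀ y : Fin 4 → ℤ → ℝ, MemVec T.n (T.wv y) (rw.Z1 T) → as ≤ |y T.i₀ 1| ∧ ∀ i, |y i (-T.Kb)| + aK ≤ R :=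
  T.testR8_sound (T.readoutStepWin_ok rw hok).2.2.2.2.2.1 has haK hR

/-- **(R9)** on the windowed level-0 box: for `y ∈ Z0`, tails `|v i| ≤ tv`, `Lv ∈ LvB`, every face `l < nF`:
`|covR φ (w l) (landF Lv y v) − ctr_l| + β_l ≤ rad_l − s_l`. [folklore] -/
theorem readoutStepWin_R9 (hok : (T.readoutStepWin rw).ok = true)
    {w : ℕ → List K} (hW : ∀ l < rw.base.nF, ∀ c < T.n, IntervalD.mem (φ (vget (w l) c)) (IntervalD.aget (IntervalD.lget rw.base.WJ l) c))
    {ctr β s rad : ℕ → ℝ} (hctr : ∀ l < rw.base.nF, IntervalD.mem (ctr l) (IntervalD.aget rw.base.ctrB l))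
    (hβ : ∀ l < rw.base.nF, IntervalD.mem (β l) (IntervalD.aget rw.base.βB l))
    (hs : ∀ l < rw.base.nF, IntervalD.mem (s l) (IntervalD.aget rw.base.sB l))
    (hrad : ∀ l < rw.base.nF, IntervalD.mem (rad l) (IntervalD.aget rw.base.radB l))
    {Lv : ℝ} (hLv : IntervalD.mem Lv rw.base.LvB) {v : Fin 4 → ℝ} (hv : ∀ i, |v i| ≤ rw.base.tv.toReal)
    {y : Fin 4 → ℤ → ℝ} (hy : MemVec T.n (T.wv y) (rw.Z0 T)) {l : ℕ} (hl : l < rw.base.nF) :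
    |T.covR φ (w l) (T.landF Lv y v) - ctr l| + β l ≤ rad l - s l := by
  obtain ⟨_, _, _, _, _, _, hL, h9, _⟩ := T.readoutStepWin_ok rw hok
  exact T.testR9_sound h9 hW hctr hβ hs hrad (T.mem_landF_landBox hL rw.base.prec hLv hv hy) hl

/-- **(R10w)** from the windowed read-out step: for an in-step kernel `A` at `u ∈ [u1lo, u1hi]` (`0 ≤ u`) and a real matrix
`wm ∈ [Z]`, the coordinate matrix `A·(Vc + B·wm)` lies in `VBw`. [folklore] -/
theorem readoutStepWin_R10 (hco : T.CoefOK φ) (hcB : CoefBoxOK φ T rw.base.coefB) (hH2 : rw.base.H2.size = T.n)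
    {u : ℝ} (hu0 : 0 ≤ u) (hulo : rw.u1lo.toReal ≤ u) (huhi : u ≤ rw.u1hi.toReal)
    {ω : ℤ → ℝ} (hω : ∀ i k, -T.Kb ≤ k → k ≤ T.Ka → IntervalD.mem ((ω k)⁻¹) (IntervalD.aget rw.base.ωinvB (T.idx i k)))
    {A : Fin 4 → ℤ → Fin 4 → ℤ → ℝ}
    (hA : ∀ i' k', -T.Kb ≤ k' → k' ≤ T.Ka → ∀ i k, -T.Kb ≤ k → k ≤ T.Ka →
      ∃ ζ : Fin 4 → ℤ → ℝ, T.InBoxW (T.vecF (IntervalD.loR rw.base.H2)) (T.vecF (IntervalD.hiR rw.base.H2)) ζ ∧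
        |A i' k' i k - ∑ n ∈ Finset.range (rw.base.pV + 1), varJet (T.toCertData φ).Qb ζ (basisSt i k) n i' k' * u ^ n|
          ≤ T.vecF (vre rw.base.JU) i' k' * (ω k)⁻¹ * u ^ (rw.base.pV + 1))
    {wm : ℕ → ℕ → ℝ} (hwm : MemMat T.n wm rw.base.Z) :
    MemMat T.n (fun r c => ∑ t ∈ Finset.range T.n, A (T.wi r) (T.wk r) (T.wi t) (T.wk t) *
        (dre rw.base.Vc t c + ∑ t' ∈ Finset.range T.n, dre rw.base.B t t' * wm t' c)) (rw.VBw T) := by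
  have ha := T.inStepMW_memMat hco hcB rw.base.prec rw.base.pV hH2 hu0 hulo huhi rw.base.JU hω hA
  have hin := memMat_addIM rw.base.prec (IntervalD.memMat_pointIM T.n rw.base.Vc) (memMat_mulDI rw.base.prec rw.base.B hwm)
  exact memMat_mulII rw.base.prec ha hin

/-- **(R11)** on the windowed level-1 box: for `y ∈ Z1`, tails `|v i| ≤ tv`, `Lv ∈ LvB`, section coefficients `φ(wσ_b) ∈ Wσ[b]`,
a real matrix `vm ∈ VBw`, a direction `ζ` with `|ζ_c| ≤ ρ_c` and the partner-face constraints, and `z` with `wv z b = Σ_c vm_{bc} ζ_c`,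
every face `l < nF` obeys `|Σ_a φ(w_{l,a})·wv (landDF Lv y v (secCorrF wσ (Qb y y) z)) a| ≤ β_l`. [folklore] -/
theorem readoutStepWin_R11 (hco : T.CoefOK φ) (hcB : CoefBoxOK φ T rw.base.coefB) (hmt : rw.base.mt = T.monosTable rw.base.coefB)
    (hok : (T.readoutStepWin rw).ok = true)
    {w : ℕ → List K} (hW : ∀ l < rw.base.nF, ∀ a < T.n, IntervalD.mem (φ (vget (w l) a)) (IntervalD.aget (IntervalD.lget rw.base.WJ l) a))
    {g : ℕ → ℕ → ℝ} (hG : ∀ l < rw.base.nF, ∀ c < T.n, IntervalD.mem (g l c) (IntervalD.aget (IntervalD.lget rw.base.G l) c))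
    {rP β : ℕ → ℝ} (hrP : ∀ l < rw.base.nF, IntervalD.mem (rP l) (IntervalD.aget rw.base.rPB l))
    (hβ : ∀ l < rw.base.nF, IntervalD.mem (β l) (IntervalD.aget rw.base.βB l))
    {Lv : ℝ} (hLv : IntervalD.mem Lv rw.base.LvB) {v : Fin 4 → ℝ} (hv : ∀ i, |v i| ≤ rw.base.tv.toReal)
    {y : Fin 4 → ℤ → ℝ} (hy : MemVec T.n (T.wv y) (rw.Z1 T))
    {wσ : List K} (hWσ : ∀ b < T.n, IntervalD.mem (φ (vget wσ b)) (IntervalD.aget rw.base.Wσ b))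
    {vm : ℕ → ℕ → ℝ} (hV : MemMat T.n vm (rw.VBw T))
    {ζ : ℕ → ℝ} (hρ : ∀ c < T.n, |ζ c| ≤ (dget rw.base.ρ c).toReal)
    (hface : ∀ l < rw.base.nF, |∑ c ∈ Finset.range T.n, g l c * ζ c| ≤ rP l)
    {z : Fin 4 → ℤ → ℝ} (hz : ∀ b < T.n, T.wv z b = ∑ c ∈ Finset.range T.n, vm b c * ζ c)
    {l : ℕ} (hl : l < rw.base.nF) :
    |∑ a ∈ Finset.range T.n, φ (vget (w l) a) * T.wv (T.landDF Lv y v (T.secCorrF φ wσ ((T.toCertData φ).Qb y y) z)) a| ≤ β l := by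
  obtain ⟨_, _, _, _, _, _, _, _, h11⟩ := T.readoutStepWin_ok rw hok
  have hFE : IntervalD.IsFieldEnclosureA T.wv (qBf (T.toCertData φ)) T.n (T.qBboxMA rw.base.coefB rw.base.prec rw.base.mt) := by
    rw [hmt]; exact T.isFieldEnclosureA_qBboxMA hco hcB rw.base.prec
  have hq : MemVec T.n (T.wv ((T.toCertData φ).Qb y y)) (rw.Fw T) := by
    intro c hc
    rw [T.Qb_diag_eq_qBf]
    exact hFE _ _ y y (T.size_Z1 rw) (T.size_Z1 rw) hy hy c hc
  exact T.testR11_sound h11 hW hG hrP hβ hLv hv hy hWσ hq hV hρ hface hz hl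

end CertTables

end Summit.NavierStokesRegularity.NavierStokesRegularity.Theorems.TaylorModelCert
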